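import Summits.HodgeConjecture.CorCM.Census.OcticWeilMixed
import HarnessLib

/-!
# MIXED products `E × B₁ × B₂ × B'` over one octic CM field (two `(2,2)`-types in general position, one `(1,3)`-type): the
# generating parts of balanced configurations, extraction, and the induction principle

COR-CM (cell `pub-hodgecm2`), seat b30 gen 20 (2026-08-22); count-neutral own lane OCTIC-WEIL-ORBIT, part MIXED; sequel of
`Census/OcticWeilMixed.lean` (model `phiM c r`, balance `ModelBalancedM`, DEFECT LAW `exists_defectM_of_modelBalancedM`).
One bookkeeping definition (`IsSix₃Part`) and theorems of a finite model; no named fact, no geometry, no `sorry`.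

* `IsSix₃Part v b G` — a Weil SIXFOLD part of sign `b`: six points, two over the curve label `inl b`, one over each
  `(2, a, b)` (a lift of the Weil weight `2[τ_b] + Σ_{s over τ_b}[s]` of `B' × E × E`, `k`-signature `(3,3)`); its count
  function; it is balanced (`IsSix₃Part.modelBalancedM`), as are pair parts and Weil parts of slots `m ≠ 2`
  (`modelBalancedM_of_isPairPart₃`, `modelBalancedM_of_isWeil₃Part`; the parts of `Census/OcticWeilOrbitParts` BY NAME);
* `exists_six₃Part_of_counts`, **`exists_part_of_modelBalancedM`** — EXTRACTION from the defect law: `t_2 ≠ 0` ⇒ a sixfold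
  part of the sign of `t_2` (`|e| = 2|t_2| ≥ 2` curve points); else some `t_m ≠ 0`, `m < 2` ⇒ a Weil part; else a pair part;
* **`modelBalancedM_induction`** — every balanced configuration of any product of copies of `E, B₁, B₂, B'` is reached from
  `∅` by adjoining disjoint pair parts, Weil parts of slots `0, 1` and sixfold parts.
[cite: Pohlmann1968, Thm 1] [cite: GaoUllmo2025, Thm 3.1] [cite: Milne2020HodgeClassesAV, 1.2 (a) and Thm. 1]
[cite: MoonenZarhin1995Duke, Thm. 2.4] [cite: Gordon1999HodgeAVSurvey, 5.13 (ii), 9.2.2]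

## References
* [Pohlmann1968] H. Pohlmann, Ann. of Math. 88 (1968), Thm 1.  [GaoUllmo2025] Z. Gao, E. Ullmo, J. Inst. Math. Jussieu 25
  (2025), Thm 3.1.  [Milne2020HodgeClassesAV] J. S. Milne, arXiv:2010.08857, 1.2 (a), Thm. 1.  [MoonenZarhin1995Duke] Duke
  Math. J. 77 (1995), Thm. 2.4.  [Gordon1999HodgeAVSurvey] B. B. Gordon, CRM Monogr. 10 (1999), 5.13 (ii), 9.2.2.
-/

namespace Summit.HodgeConjecture.CorCM.Census.OcticWeilMixed

open Finset
open Summit.HodgeConjecture.CorCM.Census.OcticWeilOrbit (Pt₃ cj₃ cj₃_inl cj₃_inr cj₃_facts permTab signTab IsPairPart₃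
  IsWeil₃Part card_filter_mem_eq_sum₃ card_eq_sum₃ sum_pt₃ exists_weil₃Part_of_counts exists_pairPart₃_of_counts)

variable {α : Type*} {c : Fin 4} {v : α → Pt₃}

/-! ### The sixfold parts -/

/-- **A Weil SIXFOLD part of sign `b`**: six points, two over the curve label `inl b` and one over each `(2, a, b)` — a lift of
the Weil weight `2[τ_b] + Σ_{s over τ_b} [s]` of `B' × E × E` (`k`-signature `(3,3)`). [cite: MoonenZarhin1995Duke, Thm. 2.4]
[cite: Gordon1999HodgeAVSurvey, 5.13 (ii)] -/
def IsSix₃Part (v : α → Pt₃) (b : Bool) (G : Finset α) : Prop :=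
  G.card = 6 ∧ (G.filter fun x => v x = Sum.inl b).card = 2 ∧ ∀ a : Fin 4, (G.filter fun x => v x = Sum.inr (2, (a, b))).card = 1

/-- The count function of a sixfold part: `2` on `inl b`, `1` on the four `(2, a, b)`, `0` elsewhere. [folklore] -/
theorem IsSix₃Part.count_eq {b : Bool} {G : Finset α} (hG : IsSix₃Part v b G) (z : Pt₃) :
    (G.filter fun x => v x = z).card =
      if z = Sum.inl b then 2 else if ∃ a : Fin 4, z = Sum.inr (2, (a, b)) then 1 else 0 := by
  classical
  obtain ⟨hcard, hE, hB⟩ := hG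
  split_ifs with hz hz'
  · rw [hz]; exact hE
  · obtain ⟨a, rfl⟩ := hz'; exact hB a
  · push Not at hz'
    have hle : (G.filter fun x => v x = Sum.inl b).card + ∑ a : Fin 4, (G.filter fun x => v x = Sum.inr (2, (a, b))).card +
        (G.filter fun x => v x = z).card ≤ G.card := by
      have hpd : ∀ a ∈ (univ : Finset (Fin 4)), ∀ a' ∈ (univ : Finset (Fin 4)), a ≠ a' →
          Disjoint (G.filter fun x => v x = Sum.inr (2, (a, b))) (G.filter fun x => v x = Sum.inr (2, (a', b))) :=
        fun a _ a' _ haa => Finset.disjoint_filter.2 fun x _ h1 h2 => haa (by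
          have := h1.symm.trans h2; simpa using this)
      have hd1 : Disjoint (G.filter fun x => v x = Sum.inl b)
          ((univ : Finset (Fin 4)).biUnion fun a => G.filter fun x => v x = Sum.inr (2, (a, b))) :=
        (Finset.disjoint_biUnion_right _ _ _).2 fun a _ => Finset.disjoint_filter.2 fun x _ h1 h2 => by
          rw [h1] at h2; exact Sum.inl_ne_inr h2
      have hd2 : Disjoint ((G.filter fun x => v x = Sum.inl b) ∪
          (univ : Finset (Fin 4)).biUnion fun a => G.filter fun x => v x = Sum.inr (2, (a, b))) (G.filter fun x => v x = z) := by
        rw [Finset.disjoint_union_left]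
        refine ⟨Finset.disjoint_filter.2 fun x _ h1 h2 => hz (h2.symm.trans h1), ?_⟩
        exact (Finset.disjoint_biUnion_left _ _ _).2 fun a _ => Finset.disjoint_filter.2 fun x _ h1 h2 => hz' a (h2.symm.trans h1)
      rw [← Finset.card_biUnion hpd, ← Finset.card_union_of_disjoint hd1, ← Finset.card_union_of_disjoint hd2]
      exact Finset.card_le_card (Finset.union_subset (Finset.union_subset (Finset.filter_subset _ _)
        (Finset.biUnion_subset.2 fun a _ => Finset.filter_subset _ _)) (Finset.filter_subset _ _))
    simp only [hE, hB, Finset.sum_const, Finset.card_univ, Fintype.card_fin, smul_eq_mul, mul_one, hcard] at hle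
    omega

/-- **A sixfold part is balanced** (the Weil weight of `B' × E × E` is a Hodge class for every conjugate type: three of its six
points lie in each `ρ_r⁻¹(type)`). [cite: MoonenZarhin1995Duke, Thm. 2.4] -/
theorem IsSix₃Part.modelBalancedM {b : Bool} {G : Finset α} (hG : IsSix₃Part v b G) : ModelBalancedM c v G := by
  classical
  intro r
  rw [card_filter_mem_eq_sum₃, card_eq_sum₃ v G]
  simp only [hG.count_eq]
  have key : ∀ (c : Fin 4) (b : Bool) (r : Fin 12),
      2 * ∑ z ∈ phiM c r, (if z = Sum.inl b then 2 else if ∃ a : Fin 4, z = Sum.inr (2, (a, b)) then 1 else 0) =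
        ∑ z : Pt₃, (if z = Sum.inl b then 2 else if ∃ a : Fin 4, z = Sum.inr (2, (a, b)) then 1 else 0) := by
    unfold phiM inPhiM signTabM sixTab
    decide +kernel
  exact key c b r

/-- **A pair part is balanced** in the mixed model. [cite: Gordon1999HodgeAVSurvey, 9.2.2] -/
theorem modelBalancedM_of_isPairPart₃ [DecidableEq α] {G : Finset α} (hG : IsPairPart₃ v G) : ModelBalancedM c v G := by
  obtain ⟨y, hy⟩ := hG.count_eq
  intro r
  rw [card_filter_mem_eq_sum₃, card_eq_sum₃ v G]
  simp only [hy]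
  have key : ∀ (c : Fin 4) (y : Pt₃) (r : Fin 12), 2 * ∑ z ∈ phiM c r, (if z = y ∨ z = cj₃ y then 1 else 0) =
      ∑ z : Pt₃, (if z = y ∨ z = cj₃ y then 1 else 0) := by
    unfold phiM inPhiM signTabM sixTab
    decide +kernel
  exact key c y r

/-- **A Weil part of a `(2,2)`-slot (`m ≠ 2`) is balanced** in the mixed model. [cite: MoonenZarhin1995Duke, Thm. 2.4] -/
theorem modelBalancedM_of_isWeil₃Part {m : Fin 3} (hm : m ≠ 2) {b : Bool} {G : Finset α} (hG : IsWeil₃Part v m b G) :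
    ModelBalancedM c v G := by
  classical
  intro r
  rw [card_filter_mem_eq_sum₃, card_eq_sum₃ v G]
  simp only [hG.count_eq]
  have key : ∀ (c : Fin 4) (m : Fin 3) (b : Bool) (r : Fin 12), m ≠ 2 →
      2 * ∑ z ∈ phiM c r, (if ∃ a : Fin 4, z = Sum.inr (m, (a, b)) then 1 else 0) =
        ∑ z : Pt₃, (if ∃ a : Fin 4, z = Sum.inr (m, (a, b)) then 1 else 0) := by
    unfold phiM inPhiM signTabM sixTab
    decide +kernel
  exact key c m b r hm

/-- In a sixfold part the two points over the curve label are distinct elements (two different copies of `E`). [folklore] -/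
theorem IsSix₃Part.exists_pair [DecidableEq α] {b : Bool} {G : Finset α} (hG : IsSix₃Part v b G) :
    ∃ x₁ ∈ G, ∃ x₂ ∈ G, x₁ ≠ x₂ ∧ v x₁ = Sum.inl b ∧ v x₂ = Sum.inl b := by
  obtain ⟨x₁, x₂, hne, h12⟩ := Finset.card_eq_two.1 hG.2.1
  have h1 : x₁ ∈ G.filter fun x => v x = Sum.inl b := by rw [h12]; simp
  have h2 : x₂ ∈ G.filter fun x => v x = Sum.inl b := by rw [h12]; simp
  exact ⟨x₁, (Finset.mem_filter.1 h1).1, x₂, (Finset.mem_filter.1 h2).1, hne, (Finset.mem_filter.1 h1).2,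
    (Finset.mem_filter.1 h2).2⟩

/-- Every point of a sixfold part of sign `b` lies over `inl b` or over a label `(2, a, b)`. [folklore] -/
theorem IsSix₃Part.mem_cases {b : Bool} {G : Finset α} (hG : IsSix₃Part v b G) {x : α} (hx : x ∈ G) :
    v x = Sum.inl b ∨ ∃ a : Fin 4, v x = Sum.inr (2, (a, b)) := by
  classical
  have hpos : 0 < (G.filter fun x' => v x' = v x).card := Finset.card_pos.2 ⟨x, Finset.mem_filter.2 ⟨hx, rfl⟩⟩
  rw [hG.count_eq] at hpos
  by_contra h
  push Not at h
  rw [if_neg h.1, if_neg (fun ⟨a, ha⟩ => h.2 a ha)] at hpos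
  exact lt_irrefl 0 hpos

/-- In a sixfold part, two points over the same fourfold label coincide. [folklore] -/
theorem IsSix₃Part.eq_of_inr {b : Bool} {G : Finset α} (hG : IsSix₃Part v b G) {x x' : α} (hx : x ∈ G) (hx' : x' ∈ G)
    {q : Fin 3 × (Fin 4 × Bool)} (hq : v x = Sum.inr q) (hq' : v x' = Sum.inr q) : x = x' := by
  classical
  obtain ⟨a, ha⟩ : ∃ a : Fin 4, v x = Sum.inr (2, (a, b)) := by
    rcases hG.mem_cases hx with h | h
    · rw [hq] at h; exact absurd h Sum.inr_ne_inl
    · exact h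
  have hqa : q = (2, (a, b)) := by rw [hq] at ha; exact Sum.inr.inj ha
  subst hqa
  obtain ⟨z, hz⟩ := Finset.card_eq_one.1 (hG.2.2 a)
  have hxz : x ∈ G.filter fun x => v x = Sum.inr (2, (a, b)) := Finset.mem_filter.2 ⟨hx, hq⟩
  have hx'z : x' ∈ G.filter fun x => v x = Sum.inr (2, (a, b)) := Finset.mem_filter.2 ⟨hx', hq'⟩
  rw [hz, Finset.mem_singleton] at hxz hx'z
  rw [hxz, hx'z]

/-- A sixfold part is non-empty. [folklore] -/
theorem IsSix₃Part.nonempty {b : Bool} {G : Finset α} (hG : IsSix₃Part v b G) : G.Nonempty := by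
  rw [← Finset.card_pos, hG.1]; norm_num

/-! ### Extraction and induction -/

/-- A sixfold part inside `T` from the counts: two points over `inl b` and one over each `(2, a, b)`. [folklore] -/
theorem exists_six₃Part_of_counts [DecidableEq α] {T : Finset α} (b : Bool)
    (hE : 2 ≤ (T.filter fun x => v x = Sum.inl b).card)
    (hB : ∀ a : Fin 4, 0 < (T.filter fun x => v x = Sum.inr (2, (a, b))).card) : ∃ G ⊆ T, IsSix₃Part v b G := by
  -- two curve points
  obtain ⟨C, hCT, hC2⟩ := Finset.exists_subset_card_eq hE
  -- one point over each `(2, a, b)`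
  obtain ⟨W, hWT, hW⟩ := exists_weil₃Part_of_counts (v := v) (T := T) 2 b hB
  have hCW : Disjoint C W := by
    rw [Finset.disjoint_left]
    intro x hxC hxW
    obtain ⟨a, ha⟩ := hW.exists_eq_inr hxW
    have hx := (Finset.mem_filter.1 (hCT hxC)).2
    rw [hx] at ha
    exact Sum.inl_ne_inr ha
  refine ⟨C ∪ W, Finset.union_subset (fun x hx => Finset.mem_of_mem_filter _ (hCT hx)) hWT, ?_, ?_, fun a => ?_⟩
  · rw [Finset.card_union_of_disjoint hCW, hC2, hW.1]
  · rw [Finset.filter_union, Finset.filter_true_of_mem fun x hx => (Finset.mem_filter.1 (hCT hx)).2,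
      Finset.filter_false_of_mem fun x hx => ?_, Finset.union_empty, hC2]
    obtain ⟨a, ha⟩ := hW.exists_eq_inr hx
    rw [ha]; exact Sum.inr_ne_inl
  · rw [Finset.filter_union, Finset.filter_false_of_mem fun x hx => ?_, Finset.empty_union, hW.2 a]
    rw [(Finset.mem_filter.1 (hCT hx)).2]; exact Sum.inl_ne_inr

/-- **EXTRACTION.**  A non-empty balanced configuration contains a pair part, a Weil part of slot `0` or `1`, or a sixfold part: by
the defect law, if `t_2 ≠ 0` then (sign `b` of `t_2`) the curve carries `≥ 2` points over `inl b` and slot `2` one over each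
`(2, a, b)`; else if some `t_m ≠ 0` (`m < 2`) a Weil part; else every hit label has its conjugate hit (a pair part).
[cite: Milne2020HodgeClassesAV, 1.2 (a) and Thm. 1] [cite: Dodson1984, §3.3.2 Theorem] -/
theorem exists_part_of_modelBalancedM [DecidableEq α] {T : Finset α} (hT : ModelBalancedM c v T) (hne : T.Nonempty) :
    ∃ G ⊆ T, IsPairPart₃ v G ∨ (∃ m b, m ≠ 2 ∧ IsWeil₃Part v m b G) ∨ ∃ b, IsSix₃Part v b G := by
  obtain ⟨t, ht, hE⟩ := exists_defectM_of_modelBalancedM hT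
  -- the sixfold case
  by_cases h2 : t 2 ≠ 0
  · rcases lt_or_gt_of_ne h2 with hneg | hpos
    · obtain ⟨G, hG, hS⟩ := exists_six₃Part_of_counts (v := v) (T := T) false (by omega) fun a => by
        have h := ht 2 a; omega
      exact ⟨G, hG, Or.inr (Or.inr ⟨false, hS⟩)⟩
    · obtain ⟨G, hG, hS⟩ := exists_six₃Part_of_counts (v := v) (T := T) true (by omega) fun a => by
        have h := ht 2 a; omega
      exact ⟨G, hG, Or.inr (Or.inr ⟨true, hS⟩)⟩
  push Not at h2
  -- a Weil part of slot `m ≠ 2`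
  by_cases hw : ∃ m : Fin 3, m ≠ 2 ∧ t m ≠ 0
  · obtain ⟨m, hm, htm⟩ := hw
    rcases lt_or_gt_of_ne htm with hneg | hpos
    · obtain ⟨G, hG, hW⟩ := exists_weil₃Part_of_counts (v := v) (T := T) m false fun a => by have h := ht m a; omega
      exact ⟨G, hG, Or.inr (Or.inl ⟨m, false, hm, hW⟩)⟩
    · obtain ⟨G, hG, hW⟩ := exists_weil₃Part_of_counts (v := v) (T := T) m true fun a => by have h := ht m a; omega
      exact ⟨G, hG, Or.inr (Or.inl ⟨m, true, hm, hW⟩)⟩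
  push Not at hw
  -- all `t_m = 0`: conjugation-invariant counts, a pair part
  have h0 : ∀ (m : Fin 3) (a : Fin 4), (T.filter fun x => v x = Sum.inr (m, (a, true))).card =
      (T.filter fun x => v x = Sum.inr (m, (a, false))).card := by
    intro m a
    have htm : t m = 0 := by
      by_cases hm : m = 2
      · rw [hm]; exact h2
      · exact hw m hm
    have h := ht m a
    omega
  have hEE : (T.filter fun x => v x = Sum.inl true).card = (T.filter fun x => v x = Sum.inl false).card := by omega
  obtain ⟨x, hx⟩ := hne
  have hNx : 0 < (T.filter fun x' => v x' = v x).card := Finset.card_pos.2 ⟨x, Finset.mem_filter.2 ⟨hx, rfl⟩⟩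
  have hNcx : 0 < (T.filter fun x' => v x' = cj₃ (v x)).card := by
    rcases hvx : v x with s | ⟨m, ⟨a, s⟩⟩ <;> rw [hvx] at hNx
    · cases s
      · rw [cj₃_inl, Bool.not_false]; omega
      · rw [cj₃_inl, Bool.not_true]; omega
    · have h := h0 m a
      cases s
      · rw [cj₃_inr, Bool.not_false]; omega
      · rw [cj₃_inr, Bool.not_true]; omega
  obtain ⟨G, hG, hP⟩ := exists_pairPart₃_of_counts (y := v x) hNx hNcx
  exact ⟨G, hG, Or.inl hP⟩

/-- **INDUCTION PRINCIPLE FOR BALANCED CONFIGURATIONS of the mixed model (any number of copies of `E, B₁, B₂, B'`).**  If `motive`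
holds for `∅` and passes from `R` to `G ∪ R` for `G` disjoint from `R` a pair part, a Weil part of slot `m ≠ 2`, or a sixfold
part, then `motive` holds for every balanced configuration. [cite: Milne2020HodgeClassesAV, 1.2 (a) and Thm. 1] [cite: GaoUllmo2025, Thm 3.1] -/
theorem modelBalancedM_induction [DecidableEq α] {motive : Finset α → Prop} (h0 : motive ∅)
    (hpair : ∀ G R : Finset α, Disjoint G R → IsPairPart₃ v G → motive R → motive (G ∪ R))
    (hweil : ∀ (G R : Finset α) (m : Fin 3) (b : Bool), m ≠ 2 → Disjoint G R → IsWeil₃Part v m b G → motive R → motive (G ∪ R))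
    (hsix : ∀ (G R : Finset α) (b : Bool), Disjoint G R → IsSix₃Part v b G → motive R → motive (G ∪ R))
    {T : Finset α} (hT : ModelBalancedM c v T) : motive T := by
  induction T using Finset.strongInduction with
  | H T ih =>
    by_cases hTe : T = ∅
    · subst hTe; exact h0
    obtain ⟨G, hGT, hG⟩ := exists_part_of_modelBalancedM hT (Finset.nonempty_iff_ne_empty.2 hTe)
    rcases hG with hP | ⟨m, b, hm, hW⟩ | ⟨b, hS⟩
    · have hR : ModelBalancedM c v (T \ G) := hT.sdiff (modelBalancedM_of_isPairPart₃ hP) hGT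
      have hlt : T \ G ⊂ T := Finset.sdiff_ssubset hGT hP.nonempty
      have h := hpair G (T \ G) Finset.disjoint_sdiff hP (ih _ hlt hR)
      rwa [Finset.union_sdiff_of_subset hGT] at h
    · have hR : ModelBalancedM c v (T \ G) := hT.sdiff (modelBalancedM_of_isWeil₃Part hm hW) hGT
      have hlt : T \ G ⊂ T := Finset.sdiff_ssubset hGT hW.nonempty
      have h := hweil G (T \ G) m b hm Finset.disjoint_sdiff hW (ih _ hlt hR)
      rwa [Finset.union_sdiff_of_subset hGT] at h
    · have hR : ModelBalancedM c v (T \ G) := hT.sdiff hS.modelBalancedM hGT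
      have hlt : T \ G ⊂ T := Finset.sdiff_ssubset hGT hS.nonempty
      have h := hsix G (T \ G) b Finset.disjoint_sdiff hS (ih _ hlt hR)
      rwa [Finset.union_sdiff_of_subset hGT] at h

end Summit.HodgeConjecture.CorCM.Census.OcticWeilMixed
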